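import Literature.NumberTheory.Sieve.PolynomialValuesSieveSequence
import Literature.NumberTheory.Sieve.MaynardSieveLevel
import Literature.NumberTheory.LFunctions.MertensElementary
import HarnessLib

/-!
# Route `LeeYangFibres`, crux `AbsoluteUpgrade` (stmt-Parity-14116), line `nlc-cells-absolute-clip`:
# helper file 4 for the stub `stub_singlesDecay` — divisor-type weights in the remainder sum

Elementary estimates for the weights `ω_F(d)` (number of roots of `F` modulo a squarefree `d`) that
multiply the progression sums in the remainder term of the sieve:

* `rootCount_le_pow_omega` — `ω_F(d) ≤ B^{ω(d)}` for squarefree `d` when `ω_F(p) ≤ B` for all primes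
  (multiplicativity of `ω_F(m)/m`, the tree's `isMultiplicative_rootDensity`);
* `sum_pow_omega_div_le`, `sum_pow_omega_le` — `∑_{d ≤ D} c^{ω(d)}/d ≤ exp(2c(log log D + 5))` and
  `∑_{d ≤ D} c^{ω(d)} ≤ D exp(2c(log log D + 5))` (`D ≥ 2`, `c ≥ 0`; tree:
  `sum_pow_omega_div_totient_le`, Mertens `∑_{p ≤ D} 1/p ≤ log log D + 4`);
* `exists_sum_le_card_mul` — `∑_{s ∈ S} g(s) ≤ #S · g(s⋆)` for a maximiser `s⋆`.

References: J. Maynard, Ann. of Math. 181 (2015), proof of Lemma 5.2 [MaynardAnnals2015];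
H. Halberstam, H.-E. Richert, *Sieve Methods* (1974), Ch. 2 [HalberstamRichert1974].
-/

noncomputable section

open Finset Polynomial
open scoped ArithmeticFunction.omega

namespace Summit.Parity.GeneralizedHardyLittlewood.Theorems.AbsoluteUpgrade

open Literature.NumberTheory.Sieve

/-! ### `ω_F(d) ≤ B^{ω(d)}` for squarefree `d` -/

/-- **`ω_F(d) ≤ B^{ω(d)}` for squarefree `d`** when `ω_F(p) ≤ B` for every prime `p`
(`ω_F(d)/d = ∏_{p ∣ d} ω_F(p)/p ≤ B^{ω(d)}/d`). [folklore] -/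
theorem rootCount_le_pow_omega {F : ℤ[X]} {B : ℕ}
    (hB : ∀ p : ℕ, p.Prime → polyRootCountMod ![F] p ≤ B) {d : ℕ} (hd : Squarefree d) :
    (polyRootCountMod ![F] d : ℝ) ≤ (B : ℝ) ^ ω d := by
  have hd0 : d ≠ 0 := hd.ne_zero
  have hprod := (isMultiplicative_rootDensity F).prod_primeFactors hd
  have hle : rootDensity F d ≤ ∏ p ∈ d.primeFactors, (B : ℝ) / p := by
    rw [← hprod]
    refine Finset.prod_le_prod (fun p _ => rootDensity_nonneg F p) fun p hp => ?_
    have hpp := Nat.prime_of_mem_primeFactors hp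
    rw [rootDensity_apply]
    exact div_le_div_of_nonneg_right (by exact_mod_cast hB p hpp) (Nat.cast_nonneg _)
  have hcard : d.primeFactors.card = ω d := by
    rw [ArithmeticFunction.cardDistinctFactors_apply, ← List.card_toFinset, Nat.toFinset_factors]
  have hdprod : ∏ p ∈ d.primeFactors, (p : ℝ) = d := by
    rw [← Nat.cast_prod, Nat.prod_primeFactors_of_squarefree hd]
  rw [Finset.prod_div_distrib, Finset.prod_const, hcard, hdprod, rootDensity_apply] at hle
  have hd0' : (0 : ℝ) < d := by exact_mod_cast Nat.pos_of_ne_zero hd0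
  exact (div_le_div_iff_of_pos_right hd0').1 hle

/-! ### Sums of `c^{ω(d)}` -/

/-- **`∑_{d ≤ D} c^{ω(d)}/d ≤ exp(2c (log log D + 5))`** for `c ≥ 0`, `D ≥ 2` (from the tree's
`∑_{d ≤ D} c^{ω(d)}/φ(d) ≤ exp(2c(∑_{p ≤ D} 1/p + 1))`, `1/d ≤ 1/φ(d)` and Mertens'
`∑_{p ≤ D} 1/p ≤ log log D + 4`). [cite: MaynardAnnals2015, proof of Lemma 5.2] -/
theorem sum_pow_omega_div_le : ∀ {c : ℝ}, 0 ≤ c → ∀ {D : ℕ}, 2 ≤ D → ∑ d ∈ Icc 1 D, c ^ ω d / d ≤ Real.exp (2 * c * (Real.log (Real.log D) + 5)) := by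
  intro c hc D hD
  have h1 : ∑ d ∈ Icc 1 D, c ^ ω d / d ≤ ∑ d ∈ Icc 1 D, c ^ ω d / (Nat.totient d : ℝ) := by
    refine Finset.sum_le_sum fun d hd => ?_
    have hd1 : 1 ≤ d := (Finset.mem_Icc.mp hd).1
    have hφ : (0 : ℝ) < Nat.totient d := by exact_mod_cast Nat.totient_pos.mpr (by omega)
    exact div_le_div_of_nonneg_left (by positivity) hφ (by exact_mod_cast Nat.totient_le d)
  refine h1.trans ((sum_pow_omega_div_totient_le hc D).trans ?_)
  have h2 := Literature.NumberTheory.LFunctions.MertensBound.sum_inv_prime_le D hD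
  have hc2 : 0 ≤ 2 * c := by positivity
  exact Real.exp_le_exp.mpr (mul_le_mul_of_nonneg_left (by linarith) hc2)

/-- **`∑_{d ≤ D} c^{ω(d)} ≤ D exp(2c (log log D + 5))`** for `c ≥ 0`, `D ≥ 2`. [folklore] -/
theorem sum_pow_omega_le {c : ℝ} (hc : 0 ≤ c) {D : ℕ} (hD : 2 ≤ D) :
    ∑ d ∈ Icc 1 D, c ^ ω d ≤ D * Real.exp (2 * c * (Real.log (Real.log D) + 5)) := by
  calc ∑ d ∈ Icc 1 D, c ^ ω d ≤ ∑ d ∈ Icc 1 D, (D : ℝ) * (c ^ ω d / d) := by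
        refine Finset.sum_le_sum fun d hd => ?_
        obtain ⟨hd1, hdD⟩ := Finset.mem_Icc.mp hd
        have hd0 : (0 : ℝ) < d := by exact_mod_cast hd1
        have hdD' : (d : ℝ) ≤ D := by exact_mod_cast hdD
        have hcω : 0 ≤ c ^ ω d := pow_nonneg hc _
        rw [mul_div_assoc', le_div_iff₀ hd0]
        calc c ^ ω d * d ≤ c ^ ω d * D := mul_le_mul_of_nonneg_left hdD' hcω
          _ = D * c ^ ω d := mul_comm _ _
    _ = D * ∑ d ∈ Icc 1 D, c ^ ω d / d := by rw [Finset.mul_sum]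
    _ ≤ _ := mul_le_mul_of_nonneg_left (sum_pow_omega_div_le hc hD) (Nat.cast_nonneg D)

/-! ### A maximiser bound -/

/-- `∑_{s ∈ S} g(s) ≤ #S · g(s⋆)` for a maximiser `s⋆` of `g` on `S` (any `s⋆` if `S = ∅`). [folklore] -/
theorem exists_sum_le_card_mul (S : Finset ℕ) (g : ℕ → ℝ) : ∃ s : ℕ, ∑ x ∈ S, g x ≤ #S * g s := by
  rcases S.eq_empty_or_nonempty with h | h
  · exact ⟨0, by simp [h]⟩
  · obtain ⟨s, -, hmax⟩ := Finset.exists_max_image S g h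
    refine ⟨s, ?_⟩
    calc ∑ x ∈ S, g x ≤ ∑ _x ∈ S, g s := Finset.sum_le_sum fun x hx => hmax x hx
      _ = #S * g s := by rw [Finset.sum_const, nsmul_eq_mul]

end Summit.Parity.GeneralizedHardyLittlewood.Theorems.AbsoluteUpgrade

end
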